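import Summits.Ventures.LatticeQCDFlow.Scaling.HubModeDilution
import Summits.Ventures.LatticeQCDFlow.Scaling.FlowHubModeGap
import Summits.Ventures.LatticeQCDFlow.Scaling.FlowHubProposalLaw

/-!
HONEST FRAMING: exact (Metropolis-corrected) sampling algorithms for lattice gauge theory; figures
of merit are autocorrelation/cost numbers at stated couplings and volumes; no continuum-physics
claim.

# FlowHubModeDilution — THE METASTABLE-REGIME DILUTION FLOOR WITH SECTOR-PRESERVING MAPS: ON A HUB LIST WITH ONE
# BIJECTION `φ_k` PER COLD LEVEL, `mode∘φ_k = mode`, THE FLOOR OF `HubModeDilution` HOLDS WITH `δ₂` THE SECTOR-WISE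
# ACCEPTANCE MASS OF THE MAP-ASSISTED HUB SWAPS: `Gap ≥ p(1−t)γ_A·w_⋆·min{t·δ₂·c·K/m, γ₀(1−t)w_0}/(56K)`
# (lean-2 GEN-23, ours)

Venture-side (OURS).  Cell `lqcd-flow` (pub-lqcd), unit `pub-lqcd-lean-2-g23`, 2026-08-26.  Chapter K, file 18:
`Scaling/HubModeDilution` (K16) carried through the hub-list conjugacy of `Scaling/FlowHubProposalLaw` (K4) exactly as
`Scaling/FlowHubModeGap` (J4) carried J3 through the star conjugacy: sector-preserving level maps give
sector-preserving level coordinates, the block masses and within-sector Poincaré constants of the pulled-back laws are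
those of `μ`, and the sector-wise plain-swap overlap of the pulled-back laws is the sector-wise acceptance mass of the
map-assisted swap (`hubModeOverlap_relabel`).

## What is proved

* **`flowHubMode_spectralGap_ge_mult`** — hub list `κ : Fin m → Fin K` with every hub edge `≥ c ≥ 1` times and
  `c·K ≤ m`, level maps with `mode(φ_k u) = mode u`, weights `w ≥ w_⋆ > 0`, one-sided sector persistence `p`,
  within-sector constants `γ_A`, hot between-sector (projection) constant `γ₀`, sector-wise acceptance mass `δ₂` of the
  map-assisted hub swaps: **`Gap(P^φ) ≥ p(1−t)γ_A·w_⋆·min{t·δ₂·c·K/m, γ₀(1−t)w_0}/(56K)`**.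

Reading (no numerics implied): in the metastable regime a sector-preserving flow raises the sector-wise acceptance `δ₂`
and nothing else, and the proposal law still enters only as `c/m`.  NOT CLAIMED: maps that move sectors (then
`Scaling/FlowHubEquivariantCeiling`); the matching ceiling; continuous spaces; anything measured.  Literature grade (cell
rule): OWN COMPOSITION (K16 + J4's transfer); nothing cited as a fact; no new bib keys.
-/

noncomputable section

open Finset Function
open Literature.Probability.MarkovChains
open Literature.Probability.MarkovChains.Decomposition

namespace Summit.Ventures.LatticeQCDFlow.Scaling

section FlowHubModeDilution

variable {S J : Type*} [Fintype S] [DecidableEq S] [Fintype J] [DecidableEq J] {K m : ℕ}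
  {μ : Fin (K + 1) → S → ℝ} {M : Fin (K + 1) → S → S → ℝ} {w : Fin (K + 1) → ℝ} {mode : S → J} {t : ℝ}
  (κ : Fin m → Fin K) (φ : Fin K → Equiv.Perm S)

/-- **THE METASTABLE-REGIME DILUTION FLOOR WITH SECTOR-PRESERVING MAPS ON A HUB LIST.** [ours] -/
theorem flowHubMode_spectralGap_ge_mult [Nontrivial S] (hφmode : ∀ (k : Fin K) (u : S), mode (φ k u) = mode u)
    (hμ : ∀ k x, 0 < μ k x) (hμ1 : ∀ k, ∑ x, μ k x = 1) (hmode : Function.Surjective mode) (hK : 1 ≤ K) {c : ℕ}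
    (hc : ∀ k : Fin K, c ≤ (univ.filter (fun r : Fin m => κ r = k)).card) (hc1 : 1 ≤ c) (hcm : c * K ≤ m)
    (hM : ∀ k, IsRowStochastic (M k)) (hMrev : ∀ k, DetailedBalance (μ k) (M k)) (hw0 : ∀ k, 0 ≤ w k)
    (hw1 : ∑ k, w k = 1) {wmin : ℝ} (hwmin0 : 0 < wmin) (hwmin : ∀ k, wmin ≤ w k) (ht0 : 0 < t) (ht1 : t < 1)
    {p δ₂ γ₀ γA : ℝ} (hp : 0 < p) (hp1 : p ≤ 1) (hδ0 : 0 < δ₂) (hδ1 : δ₂ ≤ 1) (hγ₀ : 0 < γ₀) (hγA : 0 < γA)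
    (hγA1 : γA ≤ 1)
    (hpers : ∀ (k : Fin K) (j : J), p * blockMass (μ k.succ) mode j ≤ blockMass (μ 0) mode j)
    (hδ : ∀ (i : Fin (K + 1) → J) (k : Fin K), i ∘ Equiv.swap (0 : Fin (K + 1)) k.succ ≠ i →
      δ₂ * min (blockMass (tensorFun μ) (fun z : Fin (K + 1) → S => mode ∘ z) i)
          (blockMass (tensorFun μ) (fun z : Fin (K + 1) → S => mode ∘ z) (i ∘ Equiv.swap (0 : Fin (K + 1)) k.succ))
        ≤ ∑ y ∈ block (fun z : Fin (K + 1) → S => mode ∘ z) i,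
            min (tensorFun μ y) (tensorFun μ (edgeFlowSwap (φ k) 0 k.succ y)))
    (hgap0 : ∀ h : J → ℝ, γ₀ * lawVariance (blockMass (μ 0) mode) h
      ≤ dirichletForm (blockMass (μ 0) mode) (projectionChain (μ 0) (M 0) mode) h)
    (hgapA : ∀ k j, ∀ h : S → ℝ, γA * lawVariance (blockLaw (μ k) mode j) h
      ≤ dirichletForm (blockLaw (μ k) mode j) (restrictionChain (M k) mode) h) :
    p * (1 - t) * γA * wmin * min (t * δ₂ * c * K / m) (γ₀ * (1 - t) * w 0) / (56 * K)
      ≤ spectralGap (tensorFun μ) (fun x y : Fin (K + 1) → S =>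
          t * ptGraphSwap μ (fun r : Fin m => ((0 : Fin (K + 1)), (κ r).succ)) (fun r => φ (κ r)) x y
            + (1 - t) * prodKernel w M x y) := by
  rw [flowHubList_spectralGap_eq κ φ hμ t w]
  set L : Fin (K + 1) → Equiv.Perm S := Fin.cons (Equiv.refl S) (fun k => (φ k).symm) with hL
  have hLmode : ∀ (i : Fin (K + 1)) (u : S), mode (L i u) = mode u := starLevel_mode φ hφmode
  have hLmode' : ∀ (i : Fin (K + 1)) (u : S), mode ((L i).symm u) = mode u := starLevel_symm_mode φ hφmode
  have hL0u : ∀ u, (L 0).symm u = u := fun u => by rw [hL, starLevel_zero]; rfl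
  have hν0 : (fun u => μ 0 ((L 0).symm u)) = μ 0 := funext fun u => by rw [hL0u]
  have hM0 : (fun u v => M 0 ((L 0).symm u) ((L 0).symm v)) = M 0 := funext fun u => funext fun v => by rw [hL0u, hL0u]
  have hbm : ∀ (k : Fin (K + 1)) (j : J), blockMass (fun u => μ k ((L k).symm u)) mode j = blockMass (μ k) mode j :=
    fun k j => blockMass_relabel (L k).symm (hLmode' k) (μ k) j
  have hc' : ∀ k : Fin K, c ≤ (univ.filter (fun r : Fin m =>
      (fun r : Fin m => ((0 : Fin (K + 1)), (κ r).succ)) r = ((0 : Fin (K + 1)), k.succ))).card := fun k => by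
    rw [hubList_filter_eq κ k]; exact hc k
  refine hubModeWeighted_spectralGap_ge_mult (μ := fun i u => μ i ((L i).symm u))
    (M := fun i u v => M i ((L i).symm u) ((L i).symm v)) (mode := mode)
    (e := fun r : Fin m => ((0 : Fin (K + 1)), (κ r).succ)) (fun k u => hμ k _)
    (fun k => by rw [Equiv.sum_comp (L k).symm (μ k)]; exact hμ1 k) hmode hK (fun r => (Fin.succ_ne_zero (κ r)).symm)
    hc' hc1 hcm (fun k => ⟨fun u v => (hM k).1 _ _, fun u => ?_⟩) (fun k u v => hMrev k _ _) hw0 hw1 hwmin0 hwmin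
    ht0 ht1 hp hp1 hδ0 hδ1 hγ₀ hγA hγA1 (fun k j => by rw [hbm, hbm]; exact hpers k j) (fun i k hik => ?_) ?_
    (fun k j h => ?_)
  · simpa using (Equiv.sum_comp (L k).symm (fun v => M k ((L k).symm u) v)).trans ((hM k).2 _)
  · rw [blockMass_tensorFun_relabel L hLmode, blockMass_tensorFun_relabel L hLmode, hubModeOverlap_relabel φ hφmode]
    exact hδ i k hik
  · intro h
    have e1 : blockMass (fun u => μ 0 ((L 0).symm u)) mode = blockMass (μ 0) mode := by rw [hν0]
    have e2 : projectionChain (fun u => μ 0 ((L 0).symm u)) (fun u v => M 0 ((L 0).symm u) ((L 0).symm v)) mode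
        = projectionChain (μ 0) (M 0) mode := by rw [hν0, hM0]
    rw [e1, e2]; exact hgap0 h
  · exact blockPoincare_relabel (L k).symm (hLmode' k) j (hgapA k j) h

end FlowHubModeDilution

end Summit.Ventures.LatticeQCDFlow.Scaling

end
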